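import Mathlib
import Summits.NavierStokesRegularity.FluidComputer.AbcClassIIComplexBasesCompleteness
import Summits.NavierStokesRegularity.FluidComputer.AbcClassIIEigenpairOfComplexBases

/-!
# GROUP-B, CLASS II — THE 3-B-NESTED ROW AS «EXISTENCE AND UNIQUENESS AMONG CLASS-II EIGENVALUES»
(profile-cert-3 g8, cell `ns-blowup`, 2026-08-27)
HONEST FRAMING (D-0035/D-0074): not a claim about Navier–Stokes blow-up. WHAT THIS IS NOT: not NS evidence;
MODEL lane (NS linearised about `abcFlow 1 1 1`, class II); no certificate, number or census word moves.
**`unique_classII_eigenvalue_of_nested_certificate`** — the hypotheses of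
`isLinNSEigenvalue_near_of_nested_certificate_of_complex_bases` (a 3-B-nested row about the complex first-order
matrix `amc` of ANY complex orthonormal orbit-basis family) ⇒ there is `λ⋆` with `‖λ⋆ − λ̃‖ ≤ 2Mr₀`,
`Torus.IsLinNSEigenvalue (1/(2πR)) (abcFlow 1 1 1) (2πλ⋆)`, and EVERY classical eigenpair `(z, u)` of that
linearisation (`Torus.LinNSResolventRel … (2πz) u 0`, `u ≠ 0`) whose Fourier coefficient family is CLASS II and
with `‖z − λ⋆‖ < (1 − 2√2M²r₀)/M` has `z = λ⋆`; plus the reality clause. (= the general theorem + (D7)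
`eq_of_classII_eigenfunction_of_isolated`.) This is the operator-level sentence the census wants per row: «exactly
one class-II eigenvalue of L_R in the isolation ball, within ρ of λ̃», modulo the row's transcribed facts.
Mathlib + the files named; no new definitions. bears_on LADDER-NS N5 / Z4-a(1). [folklore].
-/

noncomputable section

open scoped BigOperators ComplexConjugate InnerProductSpace
open Finset MeasureTheory UnitAddTorus

namespace Summit.NavierStokesRegularity.FluidComputer.AbcClassIIEigenpair

open Literature.Analysis.FunctionSpaces Literature.Analysis.FunctionSpaces.Torus
open Literature.Analysis.FunctionSpaces.EuclideanSpace
open Literature.Analysis.FluidPDE Literature.Analysis.FluidPDE.SteadyLattice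
open Summit.NavierStokesRegularity.FluidComputer.AbcClassII

section Unique

variable (wf : Idx → Fam)
variable (hws : ∀ i : Idx, ∀ k ∉ i.1.1, wf i k = 0)
variable (hwt : ∀ (i : Idx) (k : Fin 3 → ℤ), ∑ j : Fin 3, ((k j : ℤ) : ℂ) * wf i k j = 0)
variable (hwII : ∀ i : Idx, IsClassII (wf i))
variable (hwon : ∀ (O : Orbit) (a b : Fin (odim O)),
  ∑ k ∈ O.1, (inner ℂ (wf ⟨O, a⟩ k) (wf ⟨O, b⟩ k) : ℂ) = if a = b then 1 else 0)
variable (amc : Idx → Idx → ℂ)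
variable (hamc : ∀ i j : Idx, amc i j =
  ∑ k ∈ i.1.1, (inner ℂ (wf i k) (Torus.lerayCoeff k (crossForm 1 1 1 (wf j) k)) : ℂ))

include hws hwt hwII hwon hamc in
/-- **3-B-nested row ⇒ existence and uniqueness among class-II eigenvalues in the isolation ball.** -/
theorem unique_classII_eigenvalue_of_nested_certificate {R : ℝ} (hR : 1 ≤ R)
    (K Kv : ℕ) (lt : ℂ)
    (vt : Idx → ℂ) (hvt0 : ∀ i, i ∉ cubeIdx Kv → vt i = 0)
    {r₀ nt : ℝ} (hr₀ : 0 ≤ r₀) (hnt : 0 ≤ nt)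
    (hres : ∑ i ∈ cubeIdx Kv ∪ (cubeIdx Kv).biUnion nbrIdx,
      ‖(if i ∈ cubeIdx Kv then (lt - ((-(onormSq i.1 / R) : ℝ) : ℂ)) * vt i else 0) -
        ∑ j ∈ cubeIdx Kv, amc i j * vt j‖ ^ 2 ≤ r₀ ^ 2)
    (hntb : ∑ i ∈ cubeIdx Kv \ cubeIdx K, ‖vt i‖ ^ 2 ≤ nt ^ 2)
    (Binv : ((↥(cubeIdx K) → ℂ) × ℂ) →ₗ[ℂ] ((↥(cubeIdx K) → ℂ) × ℂ))
    (hBinv : ∀ (c : ↥(cubeIdx K) → ℂ) (m : ℂ),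
      Binv (fun i : ↥(cubeIdx K) => (lt - ((-(onormSq i.1.1 / R) : ℝ) : ℂ)) * c i -
          ∑ j : ↥(cubeIdx K), amc i j * c j + m * vt i,
        ∑ i : ↥(cubeIdx K), conj (vt i) * c i) = (c, m))
    {α βB βC gB : ℝ} (hα : 0 ≤ α) (hβB : 0 ≤ βB) (hβC : 0 ≤ βC) (hgB : 0 ≤ gB)
    (hαM : ∀ (c : ↥(cubeIdx K) → ℂ) (g : ℂ),
      ∑ j : ↥(cubeIdx K), ‖(Binv (c, g)).1 j‖ ^ 2 + ‖(Binv (c, g)).2‖ ^ 2 ≤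
        α ^ 2 * (∑ i : ↥(cubeIdx K), ‖c i‖ ^ 2 + ‖g‖ ^ 2))
    (hβBM : ∀ e : Idx → ℂ,
      ∑ j : ↥(cubeIdx K), ‖(Binv (fun i : ↥(cubeIdx K) => -∑ j ∈ nbrIdx i \ cubeIdx K,
          amc i j * e j, 0)).1 j‖ ^ 2 +
        ‖(Binv (fun i : ↥(cubeIdx K) => -∑ j ∈ nbrIdx i \ cubeIdx K,
          amc i j * e j, 0)).2‖ ^ 2 ≤
        βB ^ 2 * ∑ j ∈ (cubeIdx K).biUnion nbrIdx \ cubeIdx K, ‖e j‖ ^ 2)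
    (hβCM : ∀ (c : ↥(cubeIdx K) → ℂ) (g : ℂ),
      ∑ i ∈ ((cubeIdx K).biUnion nbrIdx ∪ cubeIdx Kv) \ cubeIdx K,
        ‖-∑ j : ↥(cubeIdx K), amc i j * (Binv (c, g)).1 j +
          (Binv (c, g)).2 * vt i‖ ^ 2 ≤ βC ^ 2 * (∑ i : ↥(cubeIdx K), ‖c i‖ ^ 2 + ‖g‖ ^ 2))
    (hgBM : ∀ e : Idx → ℂ,
      ‖(Binv (fun i : ↥(cubeIdx K) => ∑ j ∈ nbrIdx i \ cubeIdx K,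
          amc i j * e j, 0)).2‖ ^ 2 ≤
        gB ^ 2 * ∑ j ∈ (cubeIdx K).biUnion nbrIdx \ cubeIdx K, ‖e j‖ ^ 2)
    {MU2 μ M : ℝ}
    (hshellM : ∀ e : Idx → ℂ, (∀ i ∈ cubeIdx K, e i = 0) →
      MU2 * ∑ i ∈ cubeIdx (K + 1) \ cubeIdx K, ‖e i‖ ^ 2 ≤
        ∑ i ∈ cubeIdx (K + 1) \ cubeIdx K, (lt.re - (-(onormSq i.1 / R)) - Real.sqrt 2) * ‖e i‖ ^ 2 -
        RCLike.re (∑ i ∈ (cubeIdx K).biUnion nbrIdx \ cubeIdx K,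
          conj (∑ j : ↥(cubeIdx K), amc i j *
            (Binv (fun i : ↥(cubeIdx K) => ∑ j ∈ nbrIdx i \ cubeIdx K,
              amc i j * e j, 0)).1 j) * e i))
    (htailK : MU2 ≤ lt.re + ((K : ℝ) + 2) ^ 2 / R - Real.sqrt 2)
    (hμdef : μ = MU2 - gB * nt) (hμ : 0 < μ)
    (hMdef : M = √((1 + βC ^ 2) / μ ^ 2 + (α + βB * √(1 + βC ^ 2) / μ) ^ 2))
    (hκ : 2 * Real.sqrt 2 * M ^ 2 * r₀ < 1) :
    ∃ lam : ℂ, ‖lam - lt‖ ≤ 2 * M * r₀ ∧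
      Torus.IsLinNSEigenvalue (1 / (2 * Real.pi * R)) (Torus.abcFlow 1 1 1) (2 * Real.pi * lam) ∧
      (∀ (z : ℂ) (u : UnitAddTorus (Fin 3) → EuclideanSpace ℂ (Fin 3)),
        Torus.LinNSResolventRel (1 / (2 * Real.pi * R)) (Torus.abcFlow 1 1 1) (2 * Real.pi * z) u 0 → u ≠ 0 →
          IsClassII (mFourierCoeff u) → ‖z - lam‖ < (1 - 2 * Real.sqrt 2 * M ^ 2 * r₀) / M → z = lam) ∧
      (lt.im = 0 → 2 * (2 * M * r₀) < (1 - 2 * Real.sqrt 2 * M ^ 2 * r₀) / M → lam.im = 0) := by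
  obtain ⟨lam, hclose, heig, hisol, hreal, -⟩ :=
    isLinNSEigenvalue_near_of_nested_certificate_of_complex_bases wf hws hwt hwII hwon amc hamc hR
      K Kv lt vt hvt0 hr₀ hnt hres hntb Binv hBinv hα hβB hβC hgB hαM hβBM hβCM hgBM hshellM htailK hμdef hμ hMdef hκ
  exact ⟨lam, hclose, heig, fun z u hu hu0 hII hz =>
    eq_of_classII_eigenfunction_of_isolated wf hws hwt hwII hwon amc hamc hR lam z hisol hu hu0 hII hz, hreal⟩

end Unique

end Summit.NavierStokesRegularity.FluidComputer.AbcClassIIEigenpair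

end
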